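import Literature.NumberTheory.Automorphic.ArchRankOneCasimirUniformFamily    -- ★ p851064 (this seat): §A frame-free + §B diagonal frame `…_le_of_contDiff_family`
import Literature.NumberTheory.Automorphic.ArchRankOneCasimirJetsCayley       -- ★ p850929 (F0P3a-p09 (g6)): frame lemmas `diagTwoNegTwo_frame`, `exists_cayleyEquiv_diagonalL_of_eq_over`, `contDiff_hasCompactSupport_comp_cayleyGL`; brings ★ `integral_comp_conj_transport`, `exists_continuousLinearEquiv_matrixConj`, `isMulRightInvariant_map_continuousMulEquiv`
import HarnessLib

/-!
# (ELL-∞-UNIF) OVER A COMPACT SMOOTH FAMILY — CAYLEY FRAME ON THE GENERIC CARRIER `U(J)`, `J = Φ₂` (the frame of ★ (B-desc) box `exists_descent_box_chartOrbG`)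
# (Varadarajan 1989 §6.4 Thms 22–24; Bouaziz 1994 §3.1 (I₁)–(I₂); Rogawski 1990 §8.2 p. 122)

Topic `NumberTheory/Automorphic`; namespace `Literature.NumberTheory.Automorphic.UnitaryGroup`.  THEOREMS ONLY (no `def`, no instance, no notation, no axiom, no named fact,
no `sorry`).  Cell `pub/hodgecm-mathlib`, crux H413 (`stmt-HodgeConjecture-24833`), F0∕P3c line LH3 (closer stub `stub_N9`, DIRECT ROAD), LETTER L1 clause (I₁) at the FACES:
the `hbd` supplier of ★ `exists_nhds_bddAbove_norm_iteratedFDeriv_orbFamGExt_of_wallDescent[_oneWall]` (`ArchOrbFamGExtFaceJetModel`) IN THE FRAME OF RECORD of the wall descent —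
the generic carrier `U(J)`, `hJ : J = (StdForm.antidiagonal 2).over ℂ`, torus arc `h · P t_z(ψ) P⁻¹ · h⁻¹` (★ p851016 (B-desc) box, ★ p850929 (A0-CASIMIR-∞) FILE 4b, ★ FILE 2b).
Seat LH3-p02 (g4); count-neutral.

THE MATHEMATICS.  With a number field `L` and a complex place `w` as frame witness, `σ_w diag(2,−2) = P̄ᵀ J P` and `e : h′ ↦ P h′ P⁻¹ : U(σ_w diag(2,−2)) ≃ₜ* U(J)`
(★ `exists_cayleyEquiv_diagonalL_of_eq_over`); for every `g` and every `ψ` (★ `integral_comp_conj_transport`)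
`F_g(ψ) := 2 sin ψ • ∫_{U(J)} g(↑↑(h · P t_z(ψ) P⁻¹ · h⁻¹)) dν = 2 sin ψ • ∫_{U(σ_w diag(2,−2))} (g ∘ Ad_P)(↑↑(h′ t_z(ψ) h′⁻¹)) d(e⁻¹_* ν)`, the diagonal-frame functional of ★ (ELL-∞) at
`a = (2,−2)`, `p = q = 1` (★ `diagTwoNegTwo_frame`) applied to `g ∘ Ad_P`.  A jointly smooth family `Θ` with one compact `X`-support stays such under `Ad_P` (a linear homeomorphism
of `M₂(ℂ)`, ★ `exists_continuousLinearEquiv_matrixConj`), so ★ §B `RankOneCasimir.exists_forall_eventually_norm_iteratedDeriv_orbitalIntegral_le_of_contDiff_family` transports: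
* **`exists_forall_eventually_norm_iteratedDeriv_orbitalIntegral_cayley_le_of_contDiff_family_of_eq_over`** — for every Haar `ν` on `U(J)`, every centre `z ∈ S¹`, every `F` bound
  by the Cayley `hF` text, every JOINTLY smooth `Θ : P → M₂(ℂ) → E` vanishing off one compact set, every compact `K` and order `n`:
  `∃ B, ∀ᶠ ψ in 𝓝[≠] 0, ∀ q ∈ K, ‖(F (Θ q))⁽ⁿ⁾ ψ‖ ≤ B`.
HONEST LABEL: HC_CM is proved only modulo the 7 printed citations (2 remaining: hLiu418 = `stmt-HodgeConjecture-24832`, h413 = `stmt-HodgeConjecture-24833`) until rung 0 closes;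
frame transport over ★ p851064 ∕ p850929, pays nothing by itself.

## References
* [Varadarajan1989] V. S. Varadarajan, *An Introduction to Harmonic Analysis on Semisimple Lie Groups*, Cambridge Stud. Adv. Math. 16 (1989), §6.4 Thms 22–24.
* [Bouaziz1994IntegralesOrbitales] A. Bouaziz, *Intégrales orbitales sur les groupes de Lie réductifs*, Ann. Sci. ÉNS 27 (1994), §3.1 (I₁)–(I₂) p. 579.
* [Rogawski1990] J. D. Rogawski, *Automorphic Representations of Unitary Groups in Three Variables*, Ann. of Math. Stud. 123 (1990), §8.2 pp. 119, 122 (the Cayley frame).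
* [PlatonovRapinchuk1994] V. Platonov, A. Rapinchuk, *Algebraic Groups and Number Theory* (1994), §2.3 (change of frame for unitary groups).
-/

set_option autoImplicit false

noncomputable section

namespace Literature.NumberTheory.Automorphic.UnitaryGroup

open _root_.Complex _root_.Matrix _root_.MeasureTheory _root_.Set _root_.Filter _root_.Topology _root_.Function _root_.NumberField _root_.NumberField.InfinitePlace
open _root_.Literature.NumberTheory.Automorphic
open scoped Matrix.Norms.Operator MatrixGroups ComplexConjugate ContDiff

variable (L : Type) [Field L] [NumberField L] (w : {w : InfinitePlace L // IsComplex w})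
  {J : Matrix (Fin 2) (Fin 2) ℂ} (hJ : J = (StdForm.antidiagonal 2).over ℂ)
  [MeasurableSpace ↥(unitaryGroupOfForm (starRingEnd ℂ) J)] [BorelSpace ↥(unitaryGroupOfForm (starRingEnd ℂ) J)]
  (ν : Measure ↥(unitaryGroupOfForm (starRingEnd ℂ) J)) [ν.IsHaarMeasure] [ν.IsMulRightInvariant]
  {E : Type} [NormedAddCommGroup E] [NormedSpace ℝ E] [CompleteSpace E]

include L w hJ in
/-- **(ELL-∞-UNIF) OVER A COMPACT SMOOTH FAMILY, CAYLEY FRAME ON `U(J)`.**  For every two-sided Haar `ν` on `U(J)` (`J = Φ₂`), every centre `z ∈ S¹`, every functional `F` bound by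
the Cayley text `F g ψ = 2 sin ψ • ∫_{U(J)} g(↑↑(h · P t_z(ψ) P⁻¹ · h⁻¹)) dν` (★ p850929's token shape), every JOINTLY smooth family `Θ : P → M₂(ℂ) → E` of test functions vanishing
off ONE compact set, every compact `K` of parameters and every order `n`: ONE constant bounds `‖(F (Θ q))⁽ⁿ⁾ ψ‖` on ONE punctured neighbourhood of the compact wall `ψ = 0`, for ALL
`q ∈ K` — ★ §B transported along `e : U(σ_w diag(2,−2)) ≃ₜ* U(J)` with the family `q ↦ Θ q ∘ Ad_P`.  The `hbd` input of ★ `…orbFamGExt_of_wallDescent[_oneWall]` in the frame of the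
★ (B-desc) box descent. [cite: Varadarajan1989, §6.4 Thm 22] [cite: Bouaziz1994IntegralesOrbitales, §3.1 (I₁)–(I₂) p. 579] [cite: Rogawski1990, §8.2 p. 122] -/
theorem exists_forall_eventually_norm_iteratedDeriv_orbitalIntegral_cayley_le_of_contDiff_family_of_eq_over
    (z : Circle) (F : (Matrix (Fin 2) (Fin 2) ℂ → E) → ℝ → E)
    (hF : ∀ (g : Matrix (Fin 2) (Fin 2) ℂ → E) (ψ : ℝ), F g ψ = (2 * Real.sin ψ) •
      ∫ h : ↥(unitaryGroupOfForm (starRingEnd ℂ) J), g (((h * (⟨(Matrix.GeneralLinearGroup.mkOfDetNeZero !![(1 : ℂ), 1; 1, -1] det_cayleyTwo_ne_zero) * circleDiagonal 2 ![z * Circle.exp ψ, z * Circle.exp (-ψ)] * ((Matrix.GeneralLinearGroup.mkOfDetNeZero !![(1 : ℂ), 1; 1, -1] det_cayleyTwo_ne_zero))⁻¹, cayley_conj_circleDiagonal_mem_of_eq_over hJ _⟩ : ↥(unitaryGroupOfForm (starRingEnd ℂ) J)) * h⁻¹ : ↥(unitaryGroupOfForm (starRingEnd ℂ) J)) : GL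 (Fin 2) ℂ) : Matrix (Fin 2) (Fin 2) ℂ) ∂ν)
    {P : Type} [NormedAddCommGroup P] [NormedSpace ℝ P] {K : Set P} (hK : IsCompact K)
    (Θ : P → Matrix (Fin 2) (Fin 2) ℂ → E) (hΘ : ContDiff ℝ ∞ (uncurry Θ)) {C : Set (Matrix (Fin 2) (Fin 2) ℂ)} (hC : IsCompact C) (hΘC : ∀ q X, X ∉ C → Θ q X = 0) (n : ℕ) :
    ∃ B : ℝ, ∀ᶠ ψ in 𝓝[≠] (0 : ℝ), ∀ q ∈ K, ‖iteratedDeriv n (F (Θ q)) ψ‖ ≤ B := by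
  obtain ⟨e, he⟩ := exists_cayleyEquiv_diagonalL_of_eq_over L w hJ
  letI : MeasurableSpace ↥(unitaryGroupOfForm (starRingEnd ℂ) ((Matrix.diagonal ![(2 : L), -2]).map w.1.embedding)) := borel _
  haveI : BorelSpace ↥(unitaryGroupOfForm (starRingEnd ℂ) ((Matrix.diagonal ![(2 : L), -2]).map w.1.embedding)) := ⟨rfl⟩
  haveI : (ν.map e.symm).IsHaarMeasure := e.symm.isHaarMeasure_map ν
  haveI : (ν.map e.symm).IsMulRightInvariant := isMulRightInvariant_map_continuousMulEquiv e.symm ν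
  obtain ⟨ha, hreal, hsgn, hqe⟩ := diagTwoNegTwo_frame L w
  -- the transported (diagonal-frame) functional
  obtain ⟨FD, hFD⟩ : ∃ FD : (Matrix (Fin 2) (Fin 2) ℂ → E) → ℝ → E, ∀ (g : Matrix (Fin 2) (Fin 2) ℂ → E) (ψ : ℝ), FD g ψ = (2 * Real.sin ψ) •
      ∫ h' : ↥(unitaryGroupOfForm (starRingEnd ℂ) ((Matrix.diagonal ![(2 : L), -2]).map w.1.embedding)), g (((h' * (⟨circleDiagonal 2 ![z * Circle.exp ψ, z * Circle.exp (-ψ)], circleDiagonal_mem_archLocal_diagonal L 2 ![(2 : L), -2] w _⟩ : ↥(unitaryGroupOfForm (starRingEnd ℂ) ((Matrix.diagonal ![(2 : L), -2]).map w.1.embedding))) * h'⁻¹ : ↥(unitaryGroupOfForm (starRingEnd ℂ) ((Matrix.diagonal ![(2 : L), -2]).map w.1.embedding))) : GL (Fin 2) ℂ) : Matrix (Fin 2) (Fin 2) ℂ) ∂(ν.map e.symm) :=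
    ⟨fun g ψ => _, fun _ _ => rfl⟩
  -- `F g = FD (g ∘ Ad_P)` for every test function `g`
  have hFF : ∀ g : Matrix (Fin 2) (Fin 2) ℂ → E, F g = FD (fun X => g ((((Matrix.GeneralLinearGroup.mkOfDetNeZero !![(1 : ℂ), 1; 1, -1] det_cayleyTwo_ne_zero) : GL (Fin 2) ℂ) : Matrix (Fin 2) (Fin 2) ℂ) * X * ((((Matrix.GeneralLinearGroup.mkOfDetNeZero !![(1 : ℂ), 1; 1, -1] det_cayleyTwo_ne_zero))⁻¹ : GL (Fin 2) ℂ) : Matrix (Fin 2) (Fin 2) ℂ))) := by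
    intro g
    funext ψ
    rw [hF, hFD]
    have hγ : (⟨(Matrix.GeneralLinearGroup.mkOfDetNeZero !![(1 : ℂ), 1; 1, -1] det_cayleyTwo_ne_zero) * circleDiagonal 2 ![z * Circle.exp ψ, z * Circle.exp (-ψ)] * ((Matrix.GeneralLinearGroup.mkOfDetNeZero !![(1 : ℂ), 1; 1, -1] det_cayleyTwo_ne_zero))⁻¹, cayley_conj_circleDiagonal_mem_of_eq_over hJ _⟩ : ↥(unitaryGroupOfForm (starRingEnd ℂ) J)) = e (⟨circleDiagonal 2 ![z * Circle.exp ψ, z * Circle.exp (-ψ)], circleDiagonal_mem_archLocal_diagonal L 2 ![(2 : L), -2] w _⟩ : ↥(unitaryGroupOfForm (starRingEnd ℂ) ((Matrix.diagonal ![(2 : L), -2]).map w.1.embedding))) :=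
      Subtype.ext (he (⟨circleDiagonal 2 ![z * Circle.exp ψ, z * Circle.exp (-ψ)], circleDiagonal_mem_archLocal_diagonal L 2 ![(2 : L), -2] w _⟩ : ↥(unitaryGroupOfForm (starRingEnd ℂ) ((Matrix.diagonal ![(2 : L), -2]).map w.1.embedding)))).symm
    rw [hγ, integral_comp_conj_transport _ _ e _ he ν g (⟨circleDiagonal 2 ![z * Circle.exp ψ, z * Circle.exp (-ψ)], circleDiagonal_mem_archLocal_diagonal L 2 ![(2 : L), -2] w _⟩ : ↥(unitaryGroupOfForm (starRingEnd ℂ) ((Matrix.diagonal ![(2 : L), -2]).map w.1.embedding)))]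
  -- the transported family `Θ′ q = Θ q ∘ Ad_P`: jointly smooth, one compact support
  obtain ⟨A, hA⟩ := exists_continuousLinearEquiv_matrixConj (Matrix.GeneralLinearGroup.mkOfDetNeZero !![(1 : ℂ), 1; 1, -1] det_cayleyTwo_ne_zero)
  set Θ' : P → Matrix (Fin 2) (Fin 2) ℂ → E := fun q X => Θ q (A X) with hΘ'
  have hΘ's : ContDiff ℝ ∞ (uncurry Θ') := by
    have h : uncurry Θ' = uncurry Θ ∘ fun z : P × Matrix (Fin 2) (Fin 2) ℂ => (z.1, A z.2) := by
      funext z; rfl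
    rw [h]
    exact hΘ.comp (contDiff_fst.prodMk (A.contDiff.comp contDiff_snd))
  have hC' : IsCompact (A ⁻¹' C) := A.toHomeomorph.isCompact_preimage.2 hC
  have hΘ'C : ∀ q X, X ∉ A ⁻¹' C → Θ' q X = 0 := fun q X hX => hΘC q (A X) hX
  obtain ⟨B, hB⟩ := RankOneCasimir.exists_forall_eventually_norm_iteratedDeriv_orbitalIntegral_le_of_contDiff_family L (![(2 : L), -2]) w ha hreal hsgn
    (p := 1) (q := 1) (by norm_num) hqe (ν.map e.symm) z FD hFD hK Θ' hΘ's hC' hΘ'C n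
  refine ⟨B, ?_⟩
  filter_upwards [hB] with ψ hψ q hq
  have hq' : F (Θ q) = FD (Θ' q) := by
    rw [hFF (Θ q)]
    congr 1
    funext X
    simp only [hΘ', hA]
  rw [hq']
  exact hψ q hq

end Literature.NumberTheory.Automorphic.UnitaryGroup

end
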